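import Summits.QuantumFields.YangMills.Theorems.BalabanUVNodesN07KnitTokensLandauTwoOfRows
import HarnessLib

/-!
# N07 ∕ K0ᴬ, ANY `N` — THE (min) ∧ (c→s) KNIT TOKENS FOR THE LANDAU FAMILY AT THE (47)-CARRYING CHART FROM NAMED ROWS ONLY: ✓`minTokens_ofRecord_landau_of_row84` (LANDED-3) ∘
# ✓`row84_of_eq81_slice` (LANDED-10) ∘ ✓`eq81_of_eq26_along_chart_of_landau` (LANDED-10) at the slot `T♭ := T47 H₁♭ C^{sl} ε_C`, `a₀ := A^η(U₀)`, `c := N⁻¹` — the general-`N` companion of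
# ✓`knitTokens_landau_two_of_rows` (whose (rng) ∧ (star_mem) half is `N = 2`-specific)

Cell `pub-ymgap`, seat `pub-ymgap-dag-n07-w3` (g29, WIDTH SEAT 3 on N07 [B11] = [15]); helper file keyed `--kind proof --supports stmt-QuantumFields-27238 --as helper` (K0ᴬ road);
count-neutral.  INTENT-12 of the seat.

## What is here

★★★ `minTokens_landau_of_rows` (any `N ≥ 1`, frame-free scheme of record, slot `T♭`): `star_isMinOn` ∧ `sol_of_isMinOn` for `Kc^L_ρ V = {A ∈ (102) | A + 𝔄V ∈ evHerm0, ‖A + 𝔄V‖ < ρ}`, displayed rows =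
the road's standard rows (`RegimeTok`, `FrakGSliceTok`, Lie token), the numerics (`ε₄ + a_𝔄 ≤ ρ ≤ a_C`, `2(ρ + 2a_𝔄) ≤ a₃`, `4·M·B₀·C₄·(ρ + 2a_𝔄) < γ`), the Sect. C rows `RC`, `hC` (section), symmetry of
the slot-(c) Hessian (`hsym`, = def-Y's `HessSymmTok` via ✓`hessOpOfRecord128_symm_of_hessSymmTok`), the `Δ⁽²⁾` identity in `Delta2Tok`'s shape, «`RD*(S.𝔄 V) = 0`», reality∕trace of `T47 A′` on
`evHerm0 ∩ 𝔏` (at `N = 2` theorems: LANDED-11), and THE F-H ROW «`RD*(Emap H₁♭ C^{sl} ε_C A′) = 0` on `evHerm0 ∩ 𝔏`, `‖A′‖ < ρ`».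

## Honest labels

As LANDED-10∕11: the F-H row is false for `H₁♭` off the flat locus (RR-2's TRACE FLAG F-H) ⇒ vacuous there by design; print's statement at `H_π` after def-Y's re-key.  Nothing of Bałaban's
estimates proved; K0ᴬ ⟨27238⟩ NOT closed; N07 NOT discharged; COUNT∕K UNMOVED; R4 is the conditional finite-𝕋⁴ rung `BalabanLadder.UV` only; finite torus at fixed `ε` — nothing continuum ∕ OS ∕
Clay.  **The Yang–Mills mass gap is NOT proved by any of this.**  No `sorry`, no `def`, no `instance ∕ notation ∕ set_option`; standard axioms.
[cite: Balaban1985Variational, Thm 1 p.279, Prop. 5 p.294, Prop. 6 p.295, Prop. 7 p.299, (45)–(47) p.285, (74)–(84) pp.289–290, (100)–(111) pp.293–294; Balaban1985BackgroundPropagators, (3.119) p.419, (3.124)–(3.128) pp.420–421, (3.134) p.422]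
-/

noncomputable section

open Set Metric Filter Topology
open scoped Matrix Matrix.Norms.L2Operator InnerProductSpace ComplexConjugate

namespace Summit.QuantumFields.YangMills.Theorems.N07MinTokensLandauOfRows

open Literature.MathematicalPhysics.QuantumFieldTheory.Balaban1983to89
open Literature.MathematicalPhysics.QuantumFieldTheory.Balaban1983to89.T4Continuum (T4Family)
open Literature.MathematicalPhysics.QuantumFieldTheory.Balaban1983to89.Node00
open B11Eq103H1Complex (SiteL2K BondL2K funEquiv covDivL2K)
open B11Eq111FrakG (nabla115)
open B11Eq115Space (NegSup JetSup)
open B11Eq174Chart (Regime)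
open B11Prop6Scheme (Prop4Hyp mapT)
open B11Eq90Transpose (pair27)
open B11Eq90V0primeCurrent (flat115)
open B11Eq90V0GroupComposed (T47)
open B11Eq80Current (Emap quadPart)
open B11Eq80CurrentZpow (V80Z)
open B9Eq3119DeltaPiCarrier (currentCLM)
open Summit.QuantumFields.YangMills.Theorems.N07Row110AtRecord (minTokens_ofRecord_landau_of_row84)
open Summit.QuantumFields.YangMills.Theorems.N07KnitTokensLandauTwoOfRows (row84_of_eq81_slice eq81_of_eq26_along_chart_of_landau)

section Record

variable (F : T4Family) (N : ℕ) [NeZero N] {K : ℕ} (k : ℕ) (Ω : ℕ → Set (Site (F.P K) 0)) (U₀ : GaugeField (F.P K) 0 (SU N))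
  [Fact (0 < (F.L : ℝ))] [Fact (0 < (F.P K).eta k)] (levB : PBond (F.P K) k → ℕ) [Fact (0 < c0Rec F K k)] [Fact (∀ c, 0 < wBRec F K k c)] (a : ℝ)
  (hposb : ∀ x, x ≠ 0 → 0 < RCLike.re ⟪x, laplaceAOfRecord F N k U₀ (QOfRecord F N k U₀) (QflatOfRecord F N k) a x⟫_ℂ)
  (hQ : Function.Surjective (QOfRecord F N k U₀)) (εC : ℝ)
  (Gp : SiteL2K ℂ (F.P K).d (fun _ => (F.P K).sitesPerDir 0) (c0Rec F K k) (WRec N) →ₗ[ℂ]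
    SiteL2K ℂ (F.P K).d (fun _ => (F.P K).sitesPerDir 0) (c0Rec F K k) (WRec N))
  (Δ2 : BondL2K ℂ (F.P K).d (fun _ => (F.P K).sitesPerDir 0) (c0Rec F K k) (WRec N) →ₗ[ℂ]
    BondL2K ℂ (F.P K).d (fun _ => (F.P K).sitesPerDir 0) (c0Rec F K k) (WRec N))
  (hposπ : ∀ x, x ≠ 0 → 0 < RCLike.re ⟪x, laplaceAOfRecordAt F N k U₀ (hessOpOfRecord128 F N k U₀ Gp (QflatOfRecord F N k) Δ2)
    (QOfRecord F N k U₀) (QflatOfRecord F N k) a x⟫_ℂ)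
  {b C₂ c₄ aC : ℝ}
  (RC : Regime (H1OfRecordAtBgFlat F N K k Ω U₀ levB a hposb hQ) 0 (CslOfRecord F N K k Ω U₀ levB) b 0 C₂ c₄ 0 aC εC)
  (hC : Prop4Hyp (CslOfRecord F N K k Ω U₀ levB) C₂ c₄)
  (ι : Space115Lit F N K k Ω U₀ ≃ₗ[ℂ] BondL2K ℂ (F.P K).d (fun _ => (F.P K).sitesPerDir 0) (c0Rec F K k) (WRec N))
  (hι : ∀ y, ι y = (funEquiv (phiRec N) (fun _ : B9SectCLatticeCarrier.Bond (F.P K).d (fun _ => (F.P K).sitesPerDir 0) => c0Rec F K k)).symm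
    (JetSup.equiv _ _ (nabla115 ((F.P K).eta k) (unitsOfRecord F N U₀)) y))

include hι RC hC in
/-- ★★★ **(min) ∧ (c→s) FOR THE LANDAU FAMILY AT THE (47)-CARRYING CHART, ANY `N`, FROM NAMED ROWS ONLY.** [cite: Balaban1985Variational, Thm 1 p.279, Prop. 5 p.294, Prop. 6 p.295, Prop. 7 p.299, (74)–(84) pp.289–290, (110) p.294] -/
theorem minTokens_landau_of_rows
    (hsym : ∀ x y, ⟪hessOpOfRecord128 F N k U₀ Gp (QflatOfRecord F N k) Δ2 x, y⟫_ℂ = ⟪x, hessOpOfRecord128 F N k U₀ Gp (QflatOfRecord F N k) Δ2 y⟫_ℂ)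
    (hΔ2 : ∀ A' : Space115Lit F N K k Ω U₀,
      pair27 (tauRecCLM N) (currentCLM (phiRec N) (pairLevLit F Ω k) (nabla115 ((F.P K).eta k) (unitsOfRecord F N U₀)) Δ2 A') (flat115 A') =
        -2 * pair27 (tauRecCLM N) (JOfRecordAtBg F N K k Ω U₀)
          (flat115 (H1OfRecordAtBgFlat F N K k Ω U₀ levB a hposb hQ (quadPart (CslOfRecord F N K k Ω U₀ levB) A')))) :
    ∃ M γ : ℝ, 0 ≤ M ∧ 0 < γ ∧
      ∀ (dom : Set (GaugeField (F.P K) k (SU N))) (B₀ C₄ a₃ j a𝔄 ε₄ ρ : ℝ)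
        (S : BgSchemeOnLit F N K k Ω U₀) (_hS : S = bgSchemeOfRecord F N K k Ω U₀ dom levB Gp Δ2 a hposπ hposb hQ εC B₀ C₄ a₃ j a𝔄 ε₄),
        ρ ≤ aC → ε₄ + a𝔄 ≤ ρ → 2 * (ρ + a𝔄 + a𝔄) ≤ a₃ → 4 * M * B₀ * C₄ * (ρ + a𝔄 + a𝔄) < γ →
        S.RegimeTok → FrakGSliceTok F N K k Ω U₀ Gp Δ2 a hposπ hQ → (∀ V ∈ dom, S.LieTokAt V) →
        -- the Landau row of `𝔄V = H₁B(V)` ((45) 2nd row for the slot-(c) `H₁`; read on `L²`)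
        (∀ V ∈ dom, RrOfRecord F N k U₀ (QflatOfRecord F N k) (covDivL2K ℂ (c0Rec F K k) (cRec F K k) (SRec F N U₀) (ι (S.𝔄 V))) = 0) →
        -- reality ∕ trace rows of `T47 A′` on the Landau ball (✓`conjJet_T47OfRecord_eq` any `N`; trace row ✓ at `N = 2`)
        (∀ A' : Space115Lit F N K k Ω U₀, A' ∈ S.evHerm0 → RrOfRecord F N k U₀ (QflatOfRecord F N k) (covDivL2K ℂ (c0Rec F K k) (cRec F K k) (SRec F N U₀) (ι A')) = 0 → ‖A'‖ < ρ →
          (∀ b', star (JetSup.equiv _ _ (nabla115 ((F.P K).eta k) (unitsOfRecord F N U₀)) (T47 (H1OfRecordAtBgFlat F N K k Ω U₀ levB a hposb hQ) (CslOfRecord F N K k Ω U₀ levB) εC A') b') =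
            JetSup.equiv _ _ (nabla115 ((F.P K).eta k) (unitsOfRecord F N U₀)) (T47 (H1OfRecordAtBgFlat F N K k Ω U₀ levB a hposb hQ) (CslOfRecord F N K k Ω U₀ levB) εC A') b') ∧
          (∀ b', Matrix.trace (JetSup.equiv _ _ (nabla115 ((F.P K).eta k) (unitsOfRecord F N U₀)) (T47 (H1OfRecordAtBgFlat F N K k Ω U₀ levB a hposb hQ) (CslOfRecord F N K k Ω U₀ levB) εC A') b') = 0)) →
        -- THE F-H ROW: `RD*(H₁♭ D(A′)) = 0` on the Landau ball (print's (45) 2nd row ∘ (76); false for `H₁♭` off the flat locus — RR-2's TRACE FLAG F-H)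
        (∀ A' : Space115Lit F N K k Ω U₀, A' ∈ S.evHerm0 → RrOfRecord F N k U₀ (QflatOfRecord F N k) (covDivL2K ℂ (c0Rec F K k) (cRec F K k) (SRec F N U₀) (ι A')) = 0 → ‖A'‖ < ρ →
          RrOfRecord F N k U₀ (QflatOfRecord F N k) (covDivL2K ℂ (c0Rec F K k) (cRec F K k) (SRec F N U₀) (ι (Emap (H1OfRecordAtBgFlat F N K k Ω U₀ levB a hposb hQ) (CslOfRecord F N K k Ω U₀ levB) εC A'))) = 0) →
        -- (min)
        (∀ V ∈ dom, IsMinOn (wilsonAction4 ∘ S.chartLin (fun _ => T47 (H1OfRecordAtBgFlat F N K k Ω U₀ levB a hposb hQ) (CslOfRecord F N K k Ω U₀ levB) εC) V) {A : Space115Lit F N K k Ω U₀ | A ∈ constraint102OfRecord F N K k Ω U₀ ∧ A + S.𝔄 V ∈ S.evHerm0 ∧ ‖A + S.𝔄 V‖ < ρ} (S.sol V)) ∧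
        -- (c→s)
        (∀ V ∈ dom, ∀ A ∈ {A : Space115Lit F N K k Ω U₀ | A ∈ constraint102OfRecord F N K k Ω U₀ ∧ A + S.𝔄 V ∈ S.evHerm0 ∧ ‖A + S.𝔄 V‖ < ρ},
          IsMinOn (wilsonAction4 ∘ S.chartLin (fun _ => T47 (H1OfRecordAtBgFlat F N K k Ω U₀ levB a hposb hQ) (CslOfRecord F N K k Ω U₀ levB) εC) V) {A : Space115Lit F N K k Ω U₀ | A ∈ constraint102OfRecord F N K k Ω U₀ ∧ A + S.𝔄 V ∈ S.evHerm0 ∧ ‖A + S.𝔄 V‖ < ρ} A → ‖A‖ ≤ S.ε₄ ∧ mapT (S.𝒢 V) 0 (S.W V) (S.J V) (S.𝔄 V) A = A) := by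
  have hc : (0 : ℝ) < ((N : ℕ) : ℝ)⁻¹ := by
    have hN : (0 : ℝ) < (N : ℝ) := Nat.cast_pos.2 (Nat.pos_of_ne_zero (NeZero.ne N))
    positivity
  obtain ⟨M, γ, hM, hγ, hmin⟩ := minTokens_ofRecord_landau_of_row84 F N k Ω U₀ levB a hposb hQ Gp Δ2 hposπ _ hc ι hι
  refine ⟨M, γ, hM, hγ, ?_⟩
  intro dom B₀ C₄ a₃ j a𝔄 ε₄ ρ S hS hρaC hfit hdom hnum hR h𝔊 hL h𝔄L hT47 hFH
  refine hmin dom εC B₀ C₄ a₃ j a𝔄 ε₄ ρ (fun _ => T47 (H1OfRecordAtBgFlat F N K k Ω U₀ levB a hposb hQ) (CslOfRecord F N K k Ω U₀ levB) εC) S hS hfit hdom hnum hR h𝔊 hL ?_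
  intro V hV A hA δ hδ
  subst hS
  -- the (81) VALUE row on the Landau ball, from LANDED-9∕10 at `H := H₁♭`
  have eq81 : ∀ A' : Space115Lit F N K k Ω U₀,
      A' ∈ (bgSchemeOfRecord F N K k Ω U₀ dom levB Gp Δ2 a hposπ hposb hQ εC B₀ C₄ a₃ j a𝔄 ε₄).evHerm0 →
      RrOfRecord F N k U₀ (QflatOfRecord F N k) (covDivL2K ℂ (c0Rec F K k) (cRec F K k) (SRec F N U₀) (ι A')) = 0 → ‖A'‖ < ρ →
      wilsonAction4 ((bgSchemeOfRecord F N K k Ω U₀ dom levB Gp Δ2 a hposπ hposb hQ εC B₀ C₄ a₃ j a𝔄 ε₄).chartLin (fun _ => T47 (H1OfRecordAtBgFlat F N K k Ω U₀ levB a hposb hQ) (CslOfRecord F N K k Ω U₀ levB) εC) V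
          (A' - frakAOfRecordAtBg128 F N K k Ω U₀ levB Gp Δ2 a hposπ hQ V)) =
        wilsonAction4 U₀ + ((N : ℕ) : ℝ)⁻¹ * (RCLike.re ⟪ι A', (funEquiv (phiRec N) (fun _ : B9SectCLatticeCarrier.Bond (F.P K).d (fun _ => (F.P K).sitesPerDir 0) => c0Rec F K k)).symm
            (NegSup.equiv _ _ (JOfRecordAtBg F N K k Ω U₀))⟫_ℂ +
          2⁻¹ * RCLike.re ⟪ι A', hessOpOfRecord128 F N k U₀ Gp (QflatOfRecord F N k) Δ2 (ι A')⟫_ℂ +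
          RCLike.re (V80Z (tauRecCLM N) (unitsOfRecord F N U₀) (H1OfRecordAtBgFlat F N K k Ω U₀ levB a hposb hQ)
            (CslOfRecord F N K k Ω U₀ levB) εC (JOfRecordAtBg F N K k Ω U₀) (DeltaPiCurOfRecord F N K k Ω U₀ Gp (QflatOfRecord F N k)) A')) := by
    intro A' hh hL' hlt
    obtain ⟨hXr, hXt⟩ := hT47 A' hh hL' hlt
    have hA'r : ∀ bb, star (JetSup.equiv _ _ (nabla115 ((F.P K).eta k) (unitsOfRecord F N U₀)) A' bb) = JetSup.equiv _ _ (nabla115 ((F.P K).eta k) (unitsOfRecord F N U₀)) A' bb :=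
      (N07LieTokAtOfRecordTwo.conjJet_eq_self_iff F N K k Ω U₀ A').1
        ((N07LieTokAtOfRecordTwo.mem_evHerm0_ofRecord_iff F N K k Ω U₀ dom levB Gp Δ2 a hposπ hposb hQ εC B₀ C₄ a₃ j a𝔄 ε₄ A').1 hh).1
    have h := eq81_of_eq26_along_chart_of_landau F N k Ω U₀ levB a hposb hQ εC Gp Δ2 hposπ ι hι
      (H1OfRecordAtBgFlat F N K k Ω U₀ levB a hposb hQ) (CslOfRecord F N K k Ω U₀ levB) εC dom B₀ C₄ a₃ j a𝔄 ε₄ V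
      (A' - frakAOfRecordAtBg128 F N K k Ω U₀ levB Gp Δ2 a hposπ hQ V)
      (by simpa only [sub_add_cancel] using hA'r) (by simpa only [sub_add_cancel] using hXr) (by simpa only [sub_add_cancel] using hXt)
      (by simpa only [sub_add_cancel] using hL') (by simpa only [sub_add_cancel] using hFH A' hh hL' hlt)
      (by simpa only [sub_add_cancel] using hΔ2 A')
    simpa only [sub_add_cancel] using h
  have h84 := row84_of_eq81_slice F N k Ω U₀ levB a hposb hQ εC Gp Δ2 hposπ RC hC ι hι hsym dom B₀ C₄ a₃ j a𝔄 ε₄ (fun _ => T47 (H1OfRecordAtBgFlat F N K k Ω U₀ levB a hposb hQ) (CslOfRecord F N K k Ω U₀ levB) εC) V le_rfl hρaC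
    (wilsonAction4 U₀) (((N : ℕ) : ℝ)⁻¹) (by simpa only [bgSchemeOfRecord_𝔄] using h𝔄L V hV) eq81 A
    (by simpa only [bgSchemeOfRecord_𝔄] using hA) δ hδ
  simpa only [bgSchemeOfRecord_J, bgSchemeOfRecord_W, bgSchemeOfRecord_𝔄] using h84

end Record

end Summit.QuantumFields.YangMills.Theorems.N07MinTokensLandauOfRows

end
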